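import Summits.BirchSwinnertonDyer.Rank1Residual.X12.CMRamifiedRecordSchemaIMeaning
import HarnessLib

/-!
# PART I MEANING — twin invariance: `t_cs(−27k) = t_cs(k)`, so a `TcsRow` displays `t_cs` for BOTH
# members `E_k`, `E_{k'}` of its class (cell `bsd-print-cfram`, typer seat `ty3`; addendum to
# `X12/CMRamifiedRecordSchemaIMeaning.lean`)

HONEST FRAMING (cell `bsd-print-cfram`, run/shared/lean/pub/bsd-print-cfram/, verbatim in every file
of the cell): PARTITION currency only — the leaf counts when its class theorem is in the kernel BY
NAME, flag-free; Literature named facts are statement-only with cite tags, never sorried theorems;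
every imported theorem carries its printed hypotheses verbatim; numbers, not adjectives. THIS FILE:
THEOREMS ONLY (no definition, no named fact, no `sorry`); elementary arithmetic of the closed form;
nothing about BSD is asserted or booked; no mark moves.

## What is here

The twin member of a K12r@3 class is `W' ≅ E_{k'}` with `k' = −27k`, or `k' = −k/27` when `27 ∣ k`
(PART F keeps both coefficients sixth-power-free); a `TcsRow` records only `k`. Since `W_K ≅ W'_K` the
inert Tamagawa exponent is a class invariant; in the kernel this is the elementary identity
`tcsClosedForm (−27k) = tcsClosedForm k` (`v_ℓ` is unchanged at every `ℓ ≠ 3`, `3` is never counted,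
and the `2`-adic unit is multiplied by `−27 ≡ 1 (mod 4)`):

* `factorization_natAbs_neg27_mul`, `tcsClosedForm_neg27_mul` (`k ≠ 0`);
* `padicValNat_inertTamagawaProductThree_eq_tcsClosedForm_of_twin` — for `W'` with a model
  `C • W' = (y² = x³ + k')`, `k' = −27k` or (`27 ∣ k` and `k' = −(k/27)`): `ord₃ (inertTamagawaProductThree W' K)
  = tcsClosedForm k`;
* `TcsRow.padicValNat_inertTamagawaProductThree_eq_twin` — a consistent row `r` gives
  `ord₃ (inertTamagawaProductThree W' K) = r.tcs` for every such `W'`.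

References: `X12/CMRamifiedRecordSchemaI.lean`, `X12/CMRamifiedRecordSchemaIMeaning.lean`;
[SilvermanATAEC1994] IV.9.4 and Table 4.1; HOME/ty3/CERT-TABLE-K12r.md §PART I.
-/

namespace Summit.BirchSwinnertonDyer.Rank1Residual.X12.CMRamifiedRecords

open WeierstrassCurve NumberField IsDedekindDomain

/-! ### §1 The closed form is twin-invariant -/

/-- `v_ℓ(−27k) = v_ℓ(k)` for `ℓ ≠ 3`. [folklore] -/
theorem factorization_natAbs_neg27_mul {k : ℤ} (hk : k ≠ 0) {ℓ : ℕ} (hℓ : ℓ ≠ 3) :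
    (-27 * k).natAbs.factorization ℓ = k.natAbs.factorization ℓ := by
  have hk' : k.natAbs ≠ 0 := Int.natAbs_ne_zero.2 hk
  rw [Int.natAbs_mul, Int.natAbs_neg, show (27 : ℤ).natAbs = 3 ^ 3 from rfl,
    Nat.factorization_mul (by norm_num) hk', Finsupp.add_apply, Nat.factorization_pow,
    Finsupp.smul_apply, Nat.prime_three.factorization, Finsupp.single_eq_of_ne hℓ]
  simp

/-- The prime factors of `|−27k|` are those of `|k|` and `3`. [folklore] -/
theorem primeFactors_natAbs_neg27_mul {k : ℤ} (hk : k ≠ 0) :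
    (-27 * k).natAbs.primeFactors = insert 3 k.natAbs.primeFactors := by
  have hk' : k.natAbs ≠ 0 := Int.natAbs_ne_zero.2 hk
  rw [Int.natAbs_mul, Int.natAbs_neg, show (27 : ℤ).natAbs = 3 ^ 3 from rfl,
    Nat.primeFactors_mul (by norm_num) hk', Nat.primeFactors_prime_pow (by norm_num) Nat.prime_three]
  rfl

/-- `2^{v₂ k} ∣ k` in `ℤ`. [folklore] -/
theorem two_pow_factorization_dvd (k : ℤ) : (2 : ℤ) ^ k.natAbs.factorization 2 ∣ k := by
  have h : 2 ^ k.natAbs.factorization 2 ∣ k.natAbs := Nat.ordProj_dvd k.natAbs 2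
  have h' : ((2 ^ k.natAbs.factorization 2 : ℕ) : ℤ) ∣ k := Int.natCast_dvd.2 h
  exact_mod_cast h'

/-- **`t_cs(−27k) = t_cs(k)`** (`k ≠ 0`): the `2`-adic bit is unchanged (`v₂` equal, unit part times
`−27 ≡ 1 (mod 4)`), and the counted primes `ℓ ≥ 5`, `ℓ ≡ 2 (mod 3)` with `v_ℓ mod 6 ∈ {2,4}` are the
same (`3` is never counted). [folklore] -/
theorem tcsClosedForm_neg27_mul {k : ℤ} (hk : k ≠ 0) : tcsClosedForm (-27 * k) = tcsClosedForm k := by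
  unfold tcsClosedForm
  congr 1
  · -- the `2`-adic bit
    rw [factorization_natAbs_neg27_mul hk (by norm_num)]
    set a := k.natAbs.factorization 2 with ha
    obtain ⟨u, hu⟩ := two_pow_factorization_dvd k
    have h2a : (2 : ℤ) ^ a ≠ 0 := pow_ne_zero _ two_ne_zero
    have h1 : k / (2 : ℤ) ^ a = u := by rw [hu]; exact Int.mul_ediv_cancel_left _ h2a
    have h2 : (-27 * k) / (2 : ℤ) ^ a = -27 * u := by
      rw [hu, show -27 * ((2 : ℤ) ^ a * u) = (2 : ℤ) ^ a * (-27 * u) by ring]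
      exact Int.mul_ediv_cancel_left _ h2a
    unfold twoAdicIVBit
    rw [h1, h2]
    have hiff : (-27 * u) % 4 = 1 ↔ u % 4 = 1 := by omega
    by_cases h : (a = 0 ∨ a = 2) ∧ u % 4 = 1
    · rw [if_pos h, if_pos ⟨h.1, hiff.2 h.2⟩]
    · rw [if_neg h, if_neg (fun h' => h ⟨h'.1, hiff.1 h'.2⟩)]
  · -- the count
    rw [primeFactors_natAbs_neg27_mul hk, Finset.filter_insert, if_neg (by omega)]
    refine congrArg Finset.card (Finset.filter_congr fun ℓ hℓ => ?_)
    by_cases h3 : ℓ = 3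
    · subst h3; simp
    · rw [factorization_natAbs_neg27_mul hk h3]

/-! ### §2 The twin member displays the same `t_cs` -/

section Twin

variable (K : Type) [Field K] [NumberField K] (W' : WeierstrassCurve ℚ) [W'.IsElliptic]
  {C : VariableChange ℚ} {k k' : ℤ}

/-- **`ord₃ (inertTamagawaProductThree W' K) = tcsClosedForm k` for the twin member** `W' ≅ E_{k'}`,
`k' = −27k` or (`27 ∣ k`, `k' = −(k/27)`), `k ≠ 0`, `64 ∤ k`, `[K : ℚ] = 2`, `d_K = −3`.
[cite: PollackWeston2011, Def. 3.3 and Prop. 3.7 (arXiv:math/0610694 pp. 7–8)] -/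
theorem padicValNat_inertTamagawaProductThree_eq_tcsClosedForm_of_twin (h2 : Module.finrank ℚ K = 2)
    (hd : NumberField.discr K = -3) (hM : C • W' = ⟨0, 0, 0, 0, (k' : ℚ)⟩) (hk : k ≠ 0)
    (h64 : ¬ (64 : ℤ) ∣ k) (hk' : k' = -27 * k ∨ ((27 : ℤ) ∣ k ∧ k' = -(k / 27))) :
    padicValNat 3 (X12.O11.inertTamagawaProductThree W' K) = tcsClosedForm k := by
  rcases hk' with hk' | ⟨h27, hk'⟩
  · have hk0 : k' ≠ 0 := by rw [hk']; exact mul_ne_zero (by norm_num) hk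
    have h64' : ¬ (64 : ℤ) ∣ k' := by
      rw [hk']; intro h
      exact h64 (Int.dvd_of_dvd_mul_right_of_gcd_one h (by norm_num))
    rw [padicValNat_inertTamagawaProductThree_eq_tcsClosedForm K W' h2 hd hM hk0 h64', hk',
      tcsClosedForm_neg27_mul hk]
  · obtain ⟨m, hm⟩ := h27
    have hm27 : k / 27 = m := by rw [hm]; exact Int.mul_ediv_cancel_left _ (by norm_num)
    rw [hm27] at hk'
    have hm0 : m ≠ 0 := by rintro rfl; exact hk (by rw [hm, mul_zero])
    have hk0 : k' ≠ 0 := by rw [hk']; exact neg_ne_zero.2 hm0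
    have h64' : ¬ (64 : ℤ) ∣ k' := by
      rw [hk', dvd_neg]; intro h
      exact h64 (by rw [hm]; exact dvd_mul_of_dvd_right h 27)
    have hkm : k = -27 * (-m) := by rw [hm]; ring
    rw [padicValNat_inertTamagawaProductThree_eq_tcsClosedForm K W' h2 hd hM hk0 h64', hk', hkm,
      tcsClosedForm_neg27_mul (neg_ne_zero.2 hm0)]

end Twin

/-- **A consistent `TcsRow` displays `t_cs` for the twin member too**: for every `W'` with
`C • W' = (y² = x³ + k')`, `k' = −27·r.k` or `k' = −(r.k/27)` (`27 ∣ r.k`), and `[K : ℚ] = 2`, `d_K = −3`: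
`padicValNat 3 (inertTamagawaProductThree W' K) = r.tcs`.
[cite: PollackWeston2011, Def. 3.3 and Prop. 3.7 (arXiv:math/0610694 pp. 7–8)] -/
theorem TcsRow.padicValNat_inertTamagawaProductThree_eq_twin {r : TcsRow} (hr : r.consistent = true)
    (K : Type) [Field K] [NumberField K] (h2 : Module.finrank ℚ K = 2) (hd : NumberField.discr K = -3)
    (W' : WeierstrassCurve ℚ) [W'.IsElliptic] {C : VariableChange ℚ} {k' : ℤ}
    (hM : C • W' = ⟨0, 0, 0, 0, (k' : ℚ)⟩)
    (hk' : k' = -27 * r.k ∨ ((27 : ℤ) ∣ r.k ∧ k' = -(r.k / 27))) :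
    padicValNat 3 (X12.O11.inertTamagawaProductThree W' K) = r.tcs := by
  obtain ⟨-, hk, h64⟩ := TcsRow.factorsCheck_of_consistent hr
  rw [TcsRow.tcs_eq_tcsClosedForm_of_consistent hr]
  exact padicValNat_inertTamagawaProductThree_eq_tcsClosedForm_of_twin K W' h2 hd hM hk h64 hk'

end Summit.BirchSwinnertonDyer.Rank1Residual.X12.CMRamifiedRecords
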